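import Mathlib
import HarnessLib
import HarnessLib.Audit
import Summits.NavierStokesRegularity.Statement
import Literature.Analysis.FluidPDE.ClassicalSolution
import Literature.Analysis.FluidPDE.LerayHopf
import Literature.Analysis.FluidPDE.NSVorticity
import Literature.Analysis.FluidPDE.SelfSimilarLiouville
import Summits.NavierStokesRegularity.NavierStokesRegularity.Theorems.BlowupX5bGlue
import Summits.NavierStokesRegularity.NavierStokesRegularity.Theorems.BlowupAssembly
import Literature.Analysis.FluidPDE.NSUnconditionalUniqueness
import Literature.Analysis.FluidPDE.NSLerayHopf
import Summits.NavierStokesRegularity.NavierStokesRegularity.Theorems.AdiabaticEddyClayUniqueness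
import Literature.Analysis.FluidPDE.TaoLocalisation
import HarnessLib.Audit.Status.Attr

/-!
Route: Blowup

CLOSED (refuted) 2026-08-18T19:55:24Z by gate — reason: refuted:stmt-NavierStokesRegularity-0154 (BlowupClayNonuniqueness) by Summit.NavierStokesRegularity.NavierStokesRegularity.Theorems.BlowupBlowupClayNonuniqueness_refuted — note: repair grace of 72.0 h (deadline 2026-08-18T19:55:07Z) expired without a repair — closed by the gate. The file is kept as the record of this route; refuted decls are indexed as negative knowledge (`ledger negatives`).

# Route Blowup — NavierStokesRegularity, NEGATIVE side (deciding theorem concludes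
¬NavierStokesRegularity): finite-time blow-up of the physical solution ∧ uniqueness in Fefferman's
class (A)

## Thesis X = X5a ∧ X5b
X5a (blow-up, crux BlowupExists): for some ν>0 there is a finite-energy (Leray–Hopf) classical
solution of unforced NS on
  ℝ³×[0,T), 0<T<∞, from a rapidly decaying smooth datum, which is maximal (no classical extension
past T).
X5b (uniqueness in the Clay class, support BlowupClayUniqueness): any class-(A) solution (u,p) —
jointly C^∞ on
  ℝ³×[0,∞), NS with datum u₀, sup_t ∫|u|² < ∞, NOTHING else — coincides on [0,T) with any Leray–Hopf
classical
  solution from u₀. STATUS 2026-08-15 (rev 8): X5b is PROVED IN LEAN —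
Theorems/BlowupBlowupClayNonuniquenessRefutation.lean
  derives it from Literature.Analysis.FluidPDE.tao_unconditional_uniqueness_velocity_holds (Tao2011
= arXiv:1108.1165,
  Cor. 11.4 + Rmk 11.3; axioms propext/Classical.choice/Quot.sound) along the cheapest-falsifier
recipe, and thereby REFUTES
  the loophole item BlowupClayNonuniqueness (¬X5b, stmt-NavierStokesRegularity-0154). That
refutation flipped the route
  BROKEN but strengthens it: 0154 was never a hypothesis of `closes`. Item BlowupClayUniqueness
(stmt-0153) closes the
  moment a prover re-lands the same proof as `theorem … : Blowup.BlowupClayUniqueness` (evidence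
Refutation.lean attached),
  and the route's closure then rests on X5a alone.
Lean: `BlowupExists ∧ BlowupClayUniqueness` (= target BlowupThesis), i.e.
 X5a: ∃ ν, 0<ν ∧ ∃ T, 0<T ∧ ∃ u p, Literature.Analysis.FluidPDE.IsMaximalSmoothSolution ν 0 u p T ∧
Literature.Analysis.FluidPDE.IsLerayHopfOn T ν 0 (u 0) u ∧
Literature.Analysis.FluidPDE.HasRapidSpatialDecay (u 0)
 X5b: ∀ ν, 0<ν → ∀ u₀, HasRapidSpatialDecay u₀ → ∀ u v p q T, 0<T → IsSmoothOnHalfSpace u →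
IsSmoothOnHalfSpace p →
      IsNavierStokesSolution ν 0 u₀ u p → HasBoundedEnergy u → IsClassicalNSSolutionOn (Ico 0 T) ν 0
v q →
      IsLerayHopfOn T ν 0 u₀ v → v 0 = u₀ → ∀ t ∈ Ico 0 T, u t = v t

## Assembly — deciding theorem `closes (hX5a : BlowupExists) (hX5b : BlowupClayUniqueness) :
¬NavierStokesRegularity`
Assume (A); apply it to the datum u 0 of X5a (smooth and divergence-free as a slice of a classical
solution, rapidly
decaying by hypothesis) to get a global class-(A) solution (u',p'); X5b identifies u' with u on
[0,T); (u',p') is a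
classical solution on Ici 0 (the four fields of IsClassicalNSSolutionOn are the wave-0 clauses), and
its restriction to
Ico 0 (T+1) (IsClassicalNSSolutionOn.mono, uniqueDiffOn_Ico) is a smooth extension of u past T —
contradiction with
maximality. 12 lines, sorry-free, axioms standard; identical in content to the proved item Assembly
(Literature.NS.blowup_assembly) but inlined so the deciding theorem needs no Theorems import. The
route is the
NEGATIVE-SIDE FUNNEL of the summit: any blow-up witness in the X5a shape (from CertifiedBlowup,
DssFarFieldSlaving or any
construction) refutes Clay (A) through `closes`; Assembly2 (X5a →
tao_unconditional_uniqueness_velocity → ¬A, provable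
now, fact discharged) is the in-tree form of the funnel and BlowupX5aIffNotNoBlowup records X5a ↔
¬NoBlowup (stmt-NavierStokesRegularity-0054).

Rationale: WHY THIS LINE. Clay (A) asks only for SOME smooth bounded-energy solution; Fefferman's class carries
no energy inequality, no decay of ∇u and no LPS integrability for t>0, so a blow-up of the physical
(Leray–Hopf classical) solution refutes (A) only through a uniqueness theorem for that bare class —
this is X5b, and it is exactly Tao's unconditional uniqueness (Tao2011, arXiv:1108.1165, Cor. 11.4
with Rmk 11.3: Lemma 8.1 energy + Cor. 11.1 bounded enstrophy + Cor. 4.3/Thm 5.4(iii) H¹-mild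
uniqueness), now discharged in tree
(Literature.Analysis.FluidPDE.tao_unconditional_uniqueness_velocity_holds) and, since 2026-08-15,
X5b itself is a Lean theorem as typed (proved inside
Theorems/BlowupBlowupClayNonuniquenessRefutation.lean, which refutes the loophole item ¬X5b). With
the loophole closed, the route reduces ¬(A) to X5a, the existence of finite-time blow-up from a
Schwartz-class datum, for which the evidence is Tao2016AveragedNS (averaged NS blows up),
Elgindi2021 and ChenHou2025 (Euler blow-up: C^{1,α}, resp. smooth data with boundary),
Hou2022PotentiallySingularNS / Hou2026 (numerical interior nearly self-similar NS scenario), and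
forward DSS / large self-similar solutions (BradshawTsai2017AHP, ChaeWolf2017RemovingDSS). Imported
from another area: nothing beyond PDE analysis; the route's own contribution is the Lean-level
reduction ¬(A) ⟸ X5a and the negative-knowledge edges it records. Conjecture dependency (D-0027,
human ruling 2026-08-15): the line is NOT conditional on any conjecture — Tsai's Type-I DSS
Liouville conjecture enters only NEGATED, as crux #5, i.e. as a statement this route sets out to
prove FALSE; since rev 7 its content is carried inside the route (constant unfolded), so no
@[conjecture] leaf sits in the cone and the deciding theorem `closes (hX5a : BlowupExists) (hX5b :
BlowupClayUniqueness) : ¬NavierStokesRegularity` never touches it.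
RANKED CRUXES. #2 BlowupExists — X5a: ∃ ν>0, T∈(0,∞), a classical solution on ℝ³×[0,T), Leray–Hopf
on [0,T], u(0) rapidly decaying, with no classical extension past T; equals ¬NoBlowup
(stmt-NavierStokesRegularity-0054) up to bookkeeping (why it might fail: NS may be globally regular
— every printed mechanism stops short of constant-ν smooth data on ℝ³: Elgindi2021 needs C^{1,α},
ChenHou2025 a boundary and ν=0, Hou2022/Hou2026 are numerics, Tao2016 an averaged bilinear form;
self-similar, L³-bounded and axisymmetric Type-I profiles are excluded; sources: Elgindi2021,
ChenHou2025, Hou2022PotentiallySingularNS, Tao2016AveragedNS, NecasRuzickaSverak1996,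
EscauriazaSereginSverak2003). #5 BlowupTypeIDssProfile — the CONTENT of Tsai's Type-I (rotated)
λ-DSS Liouville conjecture, NEGATED and carried inside the route as its own crux (rev 7 restates
stmt-NavierStokesRegularity-0155 definitionally-equally with the conjecture constant unfolded one
level: `¬ (∀ λ, TypeIDSSLiouville λ ∧ ∀ R, RotatedTypeIDSSLiouville λ R)` over the Literature
predicates of SelfSimilarLiouville.lean; `Iff.rfl` with ¬TypeIDSSLiouvilleConjecture in both its
Literature form and the migrated obligation
Summit.NavierStokesRegularity.NavierStokesRegularity.TypeIDSSLiouvilleConjecture, and ↔ ∃ λ R,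
¬RotatedTypeIDSSLiouville λ R by Literature.Analysis.FluidPDE.typeIDSSLiouvilleConjecture_iff — all
checked, planner Sketch.lean rc 0): for some λ>1 and R ∈ O(3) there is a nontrivial ancient mild
rotated-λ-DSS solution on ℝ³×(−∞,0) with Type-I bound |u| ≤ C₀/(|x|+√−t) (Tsai2018 Conj. 8.8–8.9
negated = BradshawTsai2017CPDE Open Problem 5.1); the analytic profile half of a DSS blow-up, shared
with the conditional bridge DssFarFieldSlaving (whose route_premise is this decl) and, in witness
form, the antecedent of the EulerMelnikovDss / QuarterTurnRdss bridges (why it might fail: the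
Liouville side may hold — backward DSS existence is open (Barker2024 p.2), λ-continuous profiles
vanish (NecasRuzickaSverak1996, Tsai1998), λ near 1 is removed under exactly this bound
(ChaeWolf2017RemovingDSS Thm 1.3), axisymmetric Type I is regular (SereginSverak2009); sources:
Barker2024, ChaeWolf2017RemovingDSS, Tsai2018, BradshawTsai2017CPDE).
KILL CRITERIA. NoBlowup (stmt-NavierStokesRegularity-0054) or any positive route proved ⇒
BlowupExists refuted ⇒ close refuted (BlowupX5aIffNotNoBlowup is the recorded edge). X5b cannot kill
the line: it is proved in Lean as typed (2026-08-15), so BlowupClayUniqueness is irrefutable, and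
the refutation of its negation BlowupClayNonuniqueness (stmt-NavierStokesRegularity-0154,
Theorems.BlowupBlowupClayNonuniqueness_refuted) is a settled negative edge recorded in `ledger
negatives`, not a break of the line — repair = drop 0154 (not load-bearing).
TypeIDSSLiouvilleConjecture proved (the obligation
Summit.NavierStokesRegularity.NavierStokesRegularity.TypeIDSSLiouvilleConjecture or its Literature
copy; `fun h5 => h5 h` refutes #5 by defeq) ⇒ #5 refuted ⇒ route BROKEN at #5, repair = drop #5 and
redirect #2 to non-DSS (Type II / nearly self-similar / Hou-type) profiles; it does not close the
route. Conversely a proof of #5 is verbatim a refutation of that obligation.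
NOT DECOMPOSED YET. The blow-up scenario behind #2 (DSS cascade via #5 + truncation of the ancient
profile to a Schwartz datum by a stable-manifold/gluing step; Hou-type axisymmetric interior
scenario; Tao-type frequency cascade) — a glued split of BlowupExists is filed only after #5 or a
sibling construction route moves. Computer assistance lives in CertifiedBlowup, which shares X5b and
the assembly.
CHEAPEST FALSIFIER. For the reduction: DISCHARGED 2026-08-15 — the typed X5b followed from
tao_unconditional_uniqueness_velocity_holds in ~35 lines (restriction Ici/Ico→Icc 0 t by
IsClassicalNSSolutionOn.mono, energy of the Leray–Hopf partner by
IsLerayHopfOn.lintegral_enorm_sq_le, H¹ datum by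
HasRapidSpatialDecay.lintegral_enorm_iteratedFDeriv_sq_lt_top; refuter rreview1), so X5b is not
misstated and the reduction ¬(A) ⟸ X5a is unconditional. For the line: a proof of NoBlowup-type
regularity in any class containing Schwartz data kills it outright; short of that,
ChaeWolf2017RemovingDSS-style exclusion of Type-I DSS profiles for ALL λ>1 kills #5.
SUPPORT. REPAIR STATE 2026-08-15 (rfix seat): the route is flagged BROKEN only because
BlowupClayNonuniqueness (¬X5b, stmt-NavierStokesRegularity-0154, support r4 — the recorded loophole
check, never a hypothesis of `closes`) was refuted, exactly as predicted here; the repair is option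
(c) `--drop BlowupClayNonuniqueness` (not load-bearing), and it is blocked by gate hygiene alone:
every item-changing edit of this route bounces on `route.multi-assembly: 2 assembly items` (Assembly
+ Assembly2), while the gate also refuses to drop, re-badge or merge-by-restate an assembly item — a
deadlock only the operator can lift (needs_repair route.multi-assembly since 2026-08-15T14:53Z; hit
by the rbadge, rconj and rfix seats). OPERATOR: re-badge Assembly2
(stmt-NavierStokesRegularity-0760) → support or drop it server-side (redundant: = closes ∘ X5b),
then apply the prepared edit dropping 0154 and TypeIDssLiouville (edit_final.json in the rfix seat
folder, note included) — or exempt repair drops that do not add an assembly from the post-check; and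
extend the grace if neither happens before 2026-08-18T19:55Z: the line is healthy and must not
auto-close `refuted`. PROVABLE NOW, candidate proofs attached as item evidence (prover business,
D-0016; rc0, axioms standard, refuter rreview1): BlowupClayUniqueness (0153 — shared by 18
negative-side routes, hence still served through them while this route is broken),
BlowupX5bViaTaoUniqueness (0728), Assembly2 (0760) and SchwartzDatumH1 (0761) from Refutation.lean;
BlowupClayIsLH (0722), BlowupClassicalLHLinftySubstrips (0723), BlowupX5aIffNotNoBlowup (0730, pure
logic: IsMaximalSmoothSolution := IsClassicalNSSolutionOn ∧ ¬HasSmoothExtensionPast) and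
BlowupB2OfTaoSobolevBounds (0731) from Supports.lean. PROVED: Assembly (X5a ∧ X5b → ¬A,
Literature.NS.blowup_assembly), BlowupX5bGlue (Literature.NS.blowup_X5b_glue). Assembly2 (X5a →
tao_unconditional_uniqueness_velocity → ¬A) is, once landed, the citable in-tree funnel theorem X5a
→ ¬A; it stays a second assembly-kind item only because of the hygiene deadlock above.
TypeIDssLiouville (stmt-NavierStokesRegularity-10721): the conjecture's content in POSITIVE form,
unfolded at rev 7 exactly like #5 (Iff.rfl with TypeIDSSLiouvilleConjecture), kept only as the
recorded NEGATIVE EDGE of #5 — rank 9, never to be staffed from this route, the route does not lean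
on it being true; TO BE DROPPED in the same operator-enabled edit, because an item C beside a crux
¬C breaks the route whichever way the conjecture resolves and, since rev 7, no @[conjecture] leaf
needs declaring. The Leray–Hopf/weak–strong detour (0722/0723/0731, glue 0724 proved) is superseded
by the Tao line, but its proofs exist (Supports.lean), so landing it is cheaper than dropping it.
SOURCES. Tao2011 (arXiv:1108.1165) Cor. 11.4, Rmk 11.3, Cor. 11.1, Lemma 8.1, Cor. 4.3, Thm
5.4(iii); Fefferman2000 (A), (4), (7); Tao2016AveragedNS; Elgindi2021; ChenHou2025;
Hou2022PotentiallySingularNS (arXiv:2107.06509); Hou2026 (arXiv:2405.10916); BradshawTsai2017AHP;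
ChaeWolf2017RemovingDSS (arXiv:1610.09464); Barker2024 (arXiv:2111.14776); Tsai2018 Conj. 8.8–8.9;
NecasRuzickaSverak1996; Tsai1998; SereginSverak2009; EscauriazaSereginSverak2003;
BealeKatoMajda1984.

Novelty: NOVELTY (searched 2026-08-14, retriage pass: `lit frontier NavierStokesRegularity --since 2020`,
`lit bridges NavierStokesRegularity --cross any`, `lit search "nearly self-similar blowup
axisymmetric Navier-Stokes" --year-from 2020`, `lit read` of arXiv:1108.1165 (pp.3,14,36,48),
arXiv:1610.09464 (p.3), arXiv:2111.14776 (p.2), arXiv:2107.06509, arXiv:2405.10916, arXiv:2604.09949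
(pp.2-4), arXiv:2606.07875 (p.2), arXiv:2510.20757 (p.2); barrier catalogue
Literature/Barriers/NavierStokesRegularity/*).
X5a (blow-up from a Schwartz datum). Nearest prior art: Hou2022PotentiallySingularNS
(arXiv:2107.06509: numerical, axisymmetric, nearly self-similar potential singularity at the origin
from smooth finite-energy data, vorticity x10^7) and Hou2026 (= arXiv:2405.10916: self-similar
blow-up only for a GENERALISED axisymmetric NS with solution-dependent viscosity and fractional
dimension 3.188); ChenHou2025 (computer-assisted smooth-data blow-up for 3D Euler WITH boundary, nu
= 0); Elgindi2021 (C^{1,alpha} Euler); Tao2016AveragedNS (Type II cascade for an averaged bilinear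
form); forward DSS existence BradshawTsai2017AHP /
Literature.Analysis.FluidPDE.chae_wolf_dss_existence. Unrefereed claims found and NOT used:
arXiv:2604.09949 (5D-lifted axisymmetric profile + interval Newton-Kantorovich, T^3, nu < nu_c ~
0.0058) and arXiv:2606.07875 (reduction of a first singularity to the axisymmetric-with-swirl
class). Delta: none on the mechanism - X5a is the literal negation of NoBlowup (stmt-N  [refs: 1108.1165, 1610.09464, 2111.14776, 2107.06509, 2405.10916, 2604.09949, 2606.07875, 2510.20757, Hou2026, ChenHou2025, Elgindi2021, Tsai2018, Barker2024, Tao2011, Fefferman2000]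

Barriers (technique_class: blowup-construction type-I-blowup-rate): - Literature.Barriers.NavierStokesRegularity.CriticalNormBlowupNecessity: applies to X5a
(Literature.Barriers.NavierStokesRegularity.CriticalNormBlowupNecessity = ess_endpoint,
seregin_L3_blowup, tao_L3_blowup_rate): any witness must have ||u(t)||_{L^3} -> infinity at T (at
least triple-logarithmically); it does not evade it - the Type-I DSS profile of
BlowupTypeIDssProfile (|u| <= C/(|x|+sqrt(-t)), weak-L^3 only) and Type II cascades are exactly the
scenarios the barrier leaves open (its evasions_known); L^3-bounded ansaetze are void.
- Literature.Barriers.NavierStokesRegularity.LeraySelfSimilarBlowupExclusion: applies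
(necas_ruzicka_sverak, tsai_selfsimilar, tsai_selfsimilar_local_energy): an EXACTLY backward
self-similar finite-energy witness is impossible; evaded only by discrete self-similarity with
lambda away from 1 (ChaeWolf2017RemovingDSS Thm 1.3 removes lambda near 1) or by non-self-similar
(Type II / nearly self-similar) profiles - the bet of crux BlowupTypeIDssProfile.
- Literature.Barriers.NavierStokesRegularity.AxisymmetricTypeIExclusion: applies to the Hou-type
axisymmetric scenario named in the thesis (SereginSverak2009 Thm 3.1; in-tree
Literature.Analysis.FluidPDE.knss_no_axisymmetric_typeI): an axisymmetric witness must blow up at a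
Type II rate, and an axisymmetric Type-I DSS profile cannot serve BlowupTypeIDssProfile; not evaded
- it constrains the scenario choice, which the route leaves open.
- Literature.Barriers.NavierStokesRegularity.SingularSetDimensi

Novelty grade: known — ROUTE REVIEW refuter rreview1-Blowup-0420b48a 2026-08-15 rev7. VERDICT keep OPEN; no blocking objection; not a recombination (closed NS routes MinimalBlowupRigidity/MonotoneCritical unrelated; Blowup = negative-side funnel shared by sibling blow-up routes). 14/14 decls rc0; closes std axioms; rev-7  (refuter refuter-rreview1-NavierStokesRegularity-Blowup-0420b48a-0, 2026-08-15T19:21:20Z; prior: arXiv:1108.1165 (Tao2011) Cor. 11.4 = arXiv Cor. 71 p.36, Fefferman2000 (A),(4),(7), arXiv:2607.09619 (PineauVicol2026) Conj 1.1, Thms 1.4/1.6/1.7/1.9, arXiv:1610.09464 (ChaeWolf2017RemovingDSS) Thm 1.3, Tsai2018 GSM192 Conj 8.8-8.9, BradshawTsai2017CPDE Open Problem 5.1/5.2, arXiv:2107.06509 (Hou2022), KNSS2009 / SereginSverak2009)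

History (route lifecycle, newest last):
- 2026-08-15T19:55:07Z · BROKEN — BlowupClayNonuniqueness (stmt-NavierStokesRegularity-0154, support) refuted by Summit.NavierStokesRegularity.NavierStokesRegularity.Theorems.BlowupBlowupClayNonuniqueness_refuted @ b034035fa03c (refuter-rreview1-NavierStokesRegularity-Blowup-0420b48a-0)
- 2026-08-16T02:17:18Z · AUTO-CRUX: 1 conjecture-grade item(s) promoted to crux (TypeIDssLiouville) — refuter vetting / tiering apply (operator:999:1362873)
- 2026-08-16T14:43:05Z · LINT AUTOFIX route.multi-assembly: kept Assembly, dropped Assembly2 (gate:hygiene)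
- 2026-08-18T19:55:24Z · CLOSED refuted — refuted:stmt-NavierStokesRegularity-0154 (BlowupClayNonuniqueness) by Summit.NavierStokesRegularity.NavierStokesRegularity.Theorems.BlowupBlowupClayNonuniqueness_refuted (grace expired, auto-close) (gate)

sub-problem: NavierStokesRegularity · status: closed(refuted) · opened planner-NavierStokesRegularity-Survey-0 2026-08-13T06:07:18Z · rev 11 · ledger route-NavierStokesRegularity-Blowup
GENERATED by the gate from the ledger (D-0016/17). Provers cite these decls: `theorem foo : Summit.NavierStokesRegularity.NavierStokesRegularity.Theses.Blowup.<Decl> := …` in Summits/NavierStokesRegularity/NavierStokesRegularity/Theorems/<Name>.lean.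
-/

namespace Summit.NavierStokesRegularity.NavierStokesRegularity.Theses.Blowup

open scoped BigOperators Topology Manifold Classical MeasureTheory ProbabilityTheory Matrix InnerProductSpace ComplexConjugate ContinuousMap
open Filter Set Function TopologicalSpace MeasureTheory

attribute [summit_statement] _root_.NavierStokesRegularity

open Literature.NS

/-- item stmt-NavierStokesRegularity-0150 · target · rank 0 · closed · moot by None · by planner
why it might fail: X5a may simply be false (global regularity = NoBlowup, stmt-0054): no constant-ν interior smooth blow-up mechanism is in print (Euler needs C^{1,α} data or a boundary; NS evidence is numerics/averaged models). Formally IsMaximalSmoothSolution forbids ANY smooth extension, decay-free.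
sources: Fefferman2000, Tao2016AveragedNS, Elgindi2021, ChenHou2025, Hou2022PotentiallySingularNS, Tao2011 (arXiv:1108.1165) Cor. 11.4
X5a: some finite-energy classical NS solution from a rapidly decaying smooth datum is maximal with
finite lifespan. X5b: Clay-class solutions (smooth on ℝ³×[0,∞), bounded energy, nothing else) agree
with the finite-energy classical solution on its interval of existence. [sources: Tao2016,
arXiv:2107.06509, ChenHou2022, Elgindi2021, Fefferman2000, arXiv:2503.14699] -/
@[route_item "route-NavierStokesRegularity-Blowup"]
def BlowupThesis : Prop :=
  (∃ ν : ℝ, 0 < ν ∧ ∃ T : ℝ, 0 < T ∧ ∃ (u : ℝ → EuclideanSpace ℝ (Fin 3) → EuclideanSpace ℝ (Fin 3)) (p : ℝ → EuclideanSpace ℝ (Fin 3) → ℝ), Literature.Analysis.FluidPDE.IsMaximalSmoothSolution ν 0 u p T ∧ Literature.Analysis.FluidPDE.IsLerayHopfOn T ν 0 (u 0) u ∧ Literature.Analysis.FluidPDE.HasRapidSpatialDecay (u 0)) ∧ (∀ ν : ℝ, 0 < ν → ∀ (u₀ : EuclideanSpace ℝ (Fin 3) → EuclideanSpace ℝ (Fin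 3)), Literature.Analysis.FluidPDE.HasRapidSpatialDecay u₀ → ∀ (u v : ℝ → EuclideanSpace ℝ (Fin 3) → EuclideanSpace ℝ (Fin 3)) (p q : ℝ → EuclideanSpace ℝ (Fin 3) → ℝ) (T : ℝ), 0 < T → Literature.Analysis.FluidPDE.IsSmoothOnHalfSpace u → Literature.Analysis.FluidPDE.IsSmoothOnHalfSpace p → Literature.Analysis.FluidPDE.IsNavierStokesSolution ν 0 u₀ u p → Literature.Analysis.FluidPDE.HasBoundedEnergy u → Literature.Analysis.FluidPDE.IsClassicalNSSolutionOn (Set.Ico 0 T) ν 0 v q → Literature.Analysis.FluidPDE.IsLerayHopfOn T ν 0 u₀ v → v 0 = u₀ → ∀ t ∈ Set.Ico 0 T, u t = v t)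

/-- item stmt-NavierStokesRegularity-0152 · crux · rank 2 · closed · moot by None · by planner
why it might fail: NS may be globally regular; all printed mechanisms stop short of constant-ν smooth data on ℝ³: Elgindi2021 needs C^{1,α}, ChenHou2025 a boundary and ν=0, Hou2022/2026 are numerics (generalised dimension), Tao2016 an averaged bilinear form; self-similar, L³-bounded, axisym. Type-I profiles excluded.
sources: Elgindi2021, ChenHou2025, Hou2022PotentiallySingularNS, Hou2026, Tao2016AveragedNS, NecasRuzickaSverak1996
∃ ν>0, T∈(0,∞) and a classical solution (u,p) on ℝ³×[0,T), Leray–Hopf on [0,T), u(0) rapidly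
decaying, admitting no classical extension past T. Hardest crux; equals ¬NoBlowup
(stmt-NavierStokesRegularity-0054) up to the div-free/smoothness bookkeeping. Scenarios: Hou's
axisymmetric interior nearly self-similar candidate (arXiv:2107.06509), DSS/Type-I cascade (crux
#5), Tao-type frequency cascade (Tao2016 programme). Euler analogues are theorems (Elgindi2021,
ChenHou2022). [sources: arXiv:2107.06509, Tao2016, Elgindi2021, ChenHou2022, BuckmasterVicol2019] -/
@[route_item "route-NavierStokesRegularity-Blowup", crux]
def BlowupExists : Prop :=
  ∃ ν : ℝ, 0 < ν ∧ ∃ T : ℝ, 0 < T ∧ ∃ (u : ℝ → EuclideanSpace ℝ (Fin 3) → EuclideanSpace ℝ (Fin 3)) (p : ℝ → EuclideanSpace ℝ (Fin 3) → ℝ), Literature.Analysis.FluidPDE.IsMaximalSmoothSolution ν 0 u p T ∧ Literature.Analysis.FluidPDE.IsLerayHopfOn T ν 0 (u 0) u ∧ Literature.Analysis.FluidPDE.HasRapidSpatialDecay (u 0)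

/-- item stmt-NavierStokesRegularity-0155 · crux · rank 5 · open · by planner
why it might fail: Liouville side may hold: backward DSS existence is a long-standing open problem (Barker2024 p.2); λ-continuous profiles vanish (NRS1996, Tsai1998); λ near 1 removed under exactly this Type-I bound (ChaeWolf2017RemovingDSS Thm 1.3; small C_*: Rmk 1.4); axisymmetric Type I regular (SereginSverak2009).
sources: Barker2024 (arXiv:2111.14776) p.2, ChaeWolf2017RemovingDSS (arXiv:1610.09464) Thms 1.1, 1.3, Rmk 1.4, NecasRuzickaSverak1996, Tsai1998, Tsai2018 Conj. 8.8-8.9, SereginSverak2009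
Negation of the in-tree wall TypeIDSSLiouvilleConjecture (Tsai GSM 192 Conj. 8.8–8.9): for some λ>1
(and rotation R) there is a nontrivial ancient mild solution on ℝ³×(−∞,0), (rotated) λ-DSS, with
Type I bound |u| ≤ C₀/(|x|+√−t). This is the analytic 'profile' half of a DSS blow-up construction;
the other half (truncation to a Schwartz datum keeping the singularity: stable manifold / gluing) is
deliberately not decomposed. Forward DSS solutions exist for every λ
(Literature.Analysis.FluidPDE.chae_wolf_dss_existence, Chae–Wolf 2017); backward self-similar
(λ-continuous) profiles are excluded in L³/L^q and under local energy bounds (necas_ruzicka_sverak,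
tsai_selfsimilar*). [sources: ChaeWolf2017, arXiv:1610.09464, KNSS2009, AlbrittonBarker2019] -/
@[route_item "route-NavierStokesRegularity-Blowup"]
def BlowupTypeIDssProfile : Prop :=
  ¬ (∀ c : ℝ, Literature.Analysis.FluidPDE.TypeIDSSLiouville c ∧ ∀ R : EuclideanSpace ℝ (Fin 3) ≃ₗᵢ[ℝ] EuclideanSpace ℝ (Fin 3), Literature.Analysis.FluidPDE.RotatedTypeIDSSLiouville c R)

/-- item stmt-NavierStokesRegularity-10721 · crux (kind.auto-crux: conjecture-grade) · rank 9 · closed · moot by None · by planner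
why it might fail: auto-crux — conjecture-grade statement (docstring avows it ('Open Problem')); it is open, so it may simply be false
sources: conjecture-registry
[support] NEGATIVE EDGE of crux #5 BlowupTypeIDssProfile (stmt-NavierStokesRegularity-0155 := ¬
this): Tsai's Type-I (rotated) λ-DSS Liouville conjecture itself — for every λ (vacuous unless λ>1)
and every R ∈ O(3), ancient mild (rotated) λ-DSS solutions on ℝ³×(−∞,0) with |u| ≤ C₀/(|x|+√−t)
vanish (Tsai2018 GSM 192 Conj. 8.8–8.9; BradshawTsai2017CPDE §5 Open Problem 5.1; partial:
ChaeWolf2017RemovingDSS arXiv:1610.09464 Thm 1.3 removes λ near 1, NecasRuzickaSverak1996/Tsai1998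
the λ-continuous case). Filed so that the conjecture leaf that #5 negates is a DECLARED item of this
route (D-0027: no undeclared conjecture in the cone), not because the line needs it true: it closes
REFUTED the moment #5 is proved (theorem : ¬TypeIDssLiouville := proof of 0155), and a PROOF of it
kills #5 and redirects crux #2 to non-DSS profiles (kill criteria). Open problem either way; not
staffed by rank. [sources: Tsai2018, BradshawTsai2017CPDE, ChaeWolf2017RemovingDSS, Barker2024] -/
@[route_item "route-NavierStokesRegularity-Blowup"]
def TypeIDssLiouville : Prop :=
  ∀ c : ℝ, Literature.Analysis.FluidPDE.TypeIDSSLiouville c ∧ ∀ R : EuclideanSpace ℝ (Fin 3) ≃ₗᵢ[ℝ] EuclideanSpace ℝ (Fin 3), Literature.Analysis.FluidPDE.RotatedTypeIDSSLiouville c R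

/-- item stmt-NavierStokesRegularity-0153 · support · rank 3 · closed · proved by Summit.NavierStokesRegularity.NavierStokesRegularity.Theorems.adiabaticEddy_clayUniqueness_proof @ 47141fc88209 (prover) · by planner
Fefferman's class (A) = jointly C^∞ on ℝ³×[0,∞) + sup_t ∫|u|² < ∞; no energy inequality, no decay of
∇u, no integrability in LPS scales is assumed. Claim: such (u,p) coincides on [0,T) with any
Leray–Hopf classical solution v from the same rapidly decaying datum. Expected route: smoothness +
bounded energy ⇒ u is a distributional solution with locally finite dissipation?? (NOT automatic:
∫∫|∇u|² may be infinite) — this is exactly the delicate point; alternatives: Liouville-type control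
of the pressure (p harmonic part must be affine ⇒ excluded by bounded energy), then local energy
inequality, then weak–strong uniqueness (Prodi 1959, Serrin 1963) against v which is in every LPS
class on compacts of [0,T). [sources: Prodi1959, Serrin1963, Fefferman2000, LemarieRieusset2002,
RobinsonRodrigoSadowski2016] -/
@[route_item "route-NavierStokesRegularity-Blowup", crux]
def BlowupClayUniqueness : Prop :=
  ∀ ν : ℝ, 0 < ν → ∀ (u₀ : EuclideanSpace ℝ (Fin 3) → EuclideanSpace ℝ (Fin 3)), Literature.Analysis.FluidPDE.HasRapidSpatialDecay u₀ → ∀ (u v : ℝ → EuclideanSpace ℝ (Fin 3) → EuclideanSpace ℝ (Fin 3)) (p q : ℝ → EuclideanSpace ℝ (Fin 3) → ℝ) (T : ℝ), 0 < T → Literature.Analysis.FluidPDE.IsSmoothOnHalfSpace u → Literature.Analysis.FluidPDE.IsSmoothOnHalfSpace p → Literature.Analysis.FluidPDE.IsNavierStokesSolution ν 0 u₀ u p → Literature.Analysis.FluidPDE.HasBoundedEnergy u → Literature.Analysis.FluidPDE.IsClassicalNSSolutionOn (Set.Ico 0 T) ν 0 v q → Literature.Analysis.FluidPDE.IsLerayHopfOn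 T ν 0 u₀ v → v 0 = u₀ → ∀ t ∈ Set.Ico 0 T, u t = v t

/-- `BlowupClayUniqueness` holds: proved by `Summit.NavierStokesRegularity.NavierStokesRegularity.Theorems.adiabaticEddy_clayUniqueness_proof` @ 47141fc88209. -/
theorem BlowupClayUniqueness_holds : BlowupClayUniqueness := _root_.Summit.NavierStokesRegularity.NavierStokesRegularity.Theorems.adiabaticEddy_clayUniqueness_proof

/-- item stmt-NavierStokesRegularity-0722 · support · rank 3 · closed · moot by None · by planner
(b1) heart of X5b (stmt-NavierStokesRegularity-0153): a Clay-class solution (u,p) — jointly smooth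
on ℝ³×[0,∞), NS with rapidly decaying datum u₀, sup_t ∫|u|² < ∞, nothing else — is a Leray–Hopf weak
solution on every [0,T]. Via the in-tree fact
Literature.Analysis.FluidPDE.IsClassicalNSSolutionOn.isLerayHopfOn (Leray1934 §III, RRS2016 Thm 4.6)
it reduces to four integrability facts on (0,T)×ℝ³: ∇u ∈ L², u ∈ L³, p·u ∈ L¹ (after renormalising p
↦ p − c(t); refuter A-0 on 0153: bounded energy pins p to the Riesz form + c(t)), u ∈ C([0,T];L²).
The energy inequality/∇u ∈ L²L² is NOT given by Fefferman's class and is the open point (Tao2011 §13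
works in a class that assumes it). Refuter A-0's recorded fallback (add ∫∫|∇u|² < ∞ as hypothesis)
is the classical case and is NOT this item. [sources: Fefferman2000, Leray1934,
RobinsonRodrigoSadowski2016, Tao2011, LemarieRieusset2002] -/
@[route_item "route-NavierStokesRegularity-Blowup"]
def BlowupClayIsLH : Prop :=
  ∀ ν : ℝ, 0 < ν → ∀ (u₀ : EuclideanSpace ℝ (Fin 3) → EuclideanSpace ℝ (Fin 3)), Literature.Analysis.FluidPDE.HasRapidSpatialDecay u₀ → ∀ (u : ℝ → EuclideanSpace ℝ (Fin 3) → EuclideanSpace ℝ (Fin 3)) (p : ℝ → EuclideanSpace ℝ (Fin 3) → ℝ), Literature.Analysis.FluidPDE.IsSmoothOnHalfSpace u → Literature.Analysis.FluidPDE.IsSmoothOnHalfSpace p → Literature.Analysis.FluidPDE.IsNavierStokesSolution ν 0 u₀ u p → Literature.Analysis.FluidPDE.HasBoundedEnergy u → ∀ T : ℝ, 0 < T → Literature.Analysis.FluidPDE.IsLerayHopfOn T ν 0 u₀ u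

/-- item stmt-NavierStokesRegularity-0728 · support · rank 3 · closed · moot by None · by planner
X5b (stmt-NavierStokesRegularity-0153, verbatim conclusion) from two named Literature facts,
bypassing the Leray–Hopf detour 0722∧0723: (h₁ :
Literature.Analysis.FluidPDE.tao_pressure_normalisation — Tao2011 Lemma 4.1(i), cite wi-04750) → (h₂
: Literature.Analysis.FluidPDE.tao_unconditional_uniqueness — Tao2011 Cor. 11.4, cite wi-04751) →
X5b. Glue (~60 lines once the facts land; to be typed then by set-signature): fix t ∈ (0,T), T' :=
(t+T)/2. (a) The Clay-class (u,p) restricted to Icc 0 T' is an almost smooth finite energy solution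
(bridge Literature.Analysis.FluidPDE.isNavierStokesSolution_and_smooth_iff +
IsClassicalNSSolutionOn.mono; HasBoundedEnergy gives sup‖u‖₂<∞); by h₁, ∇p = ∇(normalisedPressure (u
t)) for a.e. t, hence for all t by continuity of both sides in t, so (u, p̃) solves NS classically
with normalised pressure. (b) The classical Leray–Hopf (v,q) on Ico 0 T restricted to Icc 0 T' is
smooth with sup‖v‖₂<∞ (IsLerayHopfOn energy inequality); h₁ normalises q likewise. (c) Datum u₀
rapidly decaying ⇒ smooth H¹. (d) h₂ ⇒ u = v on Icc 0 T' ∋ t; t = 0 from the initial conditions.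
This is the shortest printed route to X5b flagged by grounder g6-3 on 0724; it also makes 07 -/
@[route_item "route-NavierStokesRegularity-Blowup"]
def BlowupX5bViaTaoUniqueness : Prop :=
  Literature.Analysis.FluidPDE.tao_unconditional_uniqueness_velocity → (∀ ν : ℝ, 0 < ν → ∀ (u₀ : EuclideanSpace ℝ (Fin 3) → EuclideanSpace ℝ (Fin 3)), Literature.Analysis.FluidPDE.HasRapidSpatialDecay u₀ → ∀ (u v : ℝ → EuclideanSpace ℝ (Fin 3) → EuclideanSpace ℝ (Fin 3)) (p q : ℝ → EuclideanSpace ℝ (Fin 3) → ℝ) (T : ℝ), 0 < T → Literature.Analysis.FluidPDE.IsSmoothOnHalfSpace u → Literature.Analysis.FluidPDE.IsSmoothOnHalfSpace p → Literature.Analysis.FluidPDE.IsNavierStokesSolution ν 0 u₀ u p → Literature.Analysis.FluidPDE.HasBoundedEnergy u → Literature.Analysis.FluidPDE.IsClassicalNSSolutionOn (Set.Ico 0 T) ν 0 v q → Literature.Analysis.FluidPDE.IsLerayHopfOn T ν 0 u₀ v → v 0 = u₀ → ∀ t ∈ Set.Ico 0 T, u t = v t)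

/-- item stmt-NavierStokesRegularity-0154 · support · rank 4 · closed · refuted by Summit.NavierStokesRegularity.NavierStokesRegularity.Theorems.BlowupBlowupClayNonuniqueness_refuted @ b034035fa03c (refuter) · by planner
Exhibit ν>0, a rapidly decaying u₀, a Clay-class solution (u,p) (smooth, bounded energy) and a
finite-energy classical solution v from u₀ with u t ≠ v t for some t in the common interval.
Motivation: non-uniqueness of smooth solutions from critical data (Coiculescu–Palasek
arXiv:2503.14699), forced Leray–Hopf non-uniqueness (Albritton–Brué–Colombo 2022), convex
integration (Buckmaster–Vicol 2019). If true, blow-up of the physical solution does not refute Clay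
(A) as literally stated — of independent interest to the whole problem tree. [sources:
arXiv:2503.14699, AlbrittonBrueColombo2022, BuckmasterVicol2019, Fefferman2000] -/
@[route_item "route-NavierStokesRegularity-Blowup"]
def BlowupClayNonuniqueness : Prop :=
  ¬ (∀ ν : ℝ, 0 < ν → ∀ (u₀ : EuclideanSpace ℝ (Fin 3) → EuclideanSpace ℝ (Fin 3)), Literature.Analysis.FluidPDE.HasRapidSpatialDecay u₀ → ∀ (u v : ℝ → EuclideanSpace ℝ (Fin 3) → EuclideanSpace ℝ (Fin 3)) (p q : ℝ → EuclideanSpace ℝ (Fin 3) → ℝ) (T : ℝ), 0 < T → Literature.Analysis.FluidPDE.IsSmoothOnHalfSpace u → Literature.Analysis.FluidPDE.IsSmoothOnHalfSpace p → Literature.Analysis.FluidPDE.IsNavierStokesSolution ν 0 u₀ u p → Literature.Analysis.FluidPDE.HasBoundedEnergy u → Literature.Analysis.FluidPDE.IsClassicalNSSolutionOn (Set.Ico 0 T) ν 0 v q → Literature.Analysis.FluidPDE.IsLerayHopfOn T ν 0 u₀ v → v 0 = u₀ → ∀ t ∈ Set.Ico 0 T, u t = v t)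

/-- item stmt-NavierStokesRegularity-0723 · support · rank 6 · closed · moot by None · by planner
(b2) the strong partner for weak–strong uniqueness: a classical NS solution on [0,T) that is
Leray–Hopf from a rapidly decaying datum lies in L^∞_t L^∞_x on (0,T') for every T' < T
(Literature.Analysis.FluidPDE.MemLqLp ⊤ ⊤, the r = ∞ Serrin class accepted by
Literature.Analysis.FluidPDE.weak_strong_uniqueness). TRUE in print as a composite, no single locus:
H^m persistence of the strong solution (Kato1984; MajdaBertozzi2002 Thm 3.4) + weak–strong
uniqueness (Prodi1959/Serrin1963) + regularity/decay at spatial infinity for suitable solutions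
(CKN1982) to exclude unboundedness as |x|→∞ on compact sub-strips. Same content as the non-trivial
step (3) flagged by grounder-B on stmt-NavierStokesRegularity-0094 (VorticityGeometry); 0094 follows
from this + LPS higher regularity, so a Literature composite fact
Literature.NS.sobolev_persistence_classical_LH would close both — librarian's call. [sources:
Kato1984, MajdaBertozzi2002, Prodi1959, Serrin1963, CKN1982, Leray1934] -/
@[route_item "route-NavierStokesRegularity-Blowup"]
def BlowupClassicalLHLinftySubstrips : Prop :=
  ∀ (ν T : ℝ), 0 < ν → 0 < T → ∀ (u : ℝ → EuclideanSpace ℝ (Fin 3) → EuclideanSpace ℝ (Fin 3)) (p : ℝ → EuclideanSpace ℝ (Fin 3) → ℝ), Literature.Analysis.FluidPDE.IsClassicalNSSolutionOn (Set.Ico 0 T) ν 0 u p → Literature.Analysis.FluidPDE.IsLerayHopfOn T ν 0 (u 0) u → Literature.Analysis.FluidPDE.HasRapidSpatialDecay (u 0) → ∀ T' ∈ Set.Ioo 0 T, Literature.Analysis.FluidPDE.MemLqLp ⊤ ⊤ u (Set.Ioo 0 T')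

/-- item stmt-NavierStokesRegularity-0731 · support · rank 6 · closed · moot by None · by planner
Formal glue (~10 lines) making b2 = stmt-NavierStokesRegularity-0723 close the moment the named fact
of cite item wi-04767 (Literature.NS.tao_smooth_finite_energy_sobolev_bounds; Tao2011 Cor 11.1 + Cor
4.3 + Thm 5.4(iii),(iv), CLOSED-slab Sobolev/L∞ bounds for smooth finite-energy solutions with
Schwartz datum) is vendored with the tested shape used here as hypothesis: for T′ ∈ Ioo 0 T restrict
the classical solution from Ico 0 T to Icc 0 T′ (IsClassicalNSSolutionOn.mono, uniqueDiffOn_Icc,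
0<T′), get sup_{[0,T′]}∫|u t|² < ∞ from IsLerayHopfOn.energy_ineq_zero (f = 0, dissipation ≥ 0) +
memLp + eEnergy_eq_ofReal, apply the hypothesis, project the MemLqLp ⊤ ⊤ conjunct. Provable NOW
(hypothesis form), independent of the review queue. [sources: Tao2011, Leray1934] -/
@[route_item "route-NavierStokesRegularity-Blowup"]
def BlowupB2OfTaoSobolevBounds : Prop :=
  (∀ (ν T : ℝ), 0 < ν → 0 < T → ∀ (u : ℝ → EuclideanSpace ℝ (Fin 3) → EuclideanSpace ℝ (Fin 3)) (p : ℝ → EuclideanSpace ℝ (Fin 3) → ℝ), Literature.Analysis.FluidPDE.IsClassicalNSSolutionOn (Set.Icc 0 T) ν 0 u p → (∃ C : ENNReal, C < ⊤ ∧ ∀ t ∈ Set.Icc 0 T, ∫⁻ x, ‖u t x‖ₑ ^ 2 ≤ C) → Literature.Analysis.FluidPDE.HasRapidSpatialDecay (u 0) → Literature.Analysis.FluidPDE.HasBoundedSobolevNormsOn (Set.Icc 0 T) u ∧ Literature.Analysis.FluidPDE.MemLqLp ⊤ ⊤ u (Set.Ioo 0 T)) → (∀ (ν T : ℝ), 0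 < ν → 0 < T → ∀ (u : ℝ → EuclideanSpace ℝ (Fin 3) → EuclideanSpace ℝ (Fin 3)) (p : ℝ → EuclideanSpace ℝ (Fin 3) → ℝ), Literature.Analysis.FluidPDE.IsClassicalNSSolutionOn (Set.Ico 0 T) ν 0 u p → Literature.Analysis.FluidPDE.IsLerayHopfOn T ν 0 (u 0) u → Literature.Analysis.FluidPDE.HasRapidSpatialDecay (u 0) → ∀ T' ∈ Set.Ioo 0 T, Literature.Analysis.FluidPDE.MemLqLp ⊤ ⊤ u (Set.Ioo 0 T'))

/-- item stmt-NavierStokesRegularity-0724 · support · rank 7 · closed · proved by Literature.NS.blowup_X5b_glue (refuter) · by planner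
Glue of the X5b branch: (b1: Clay-class ⇒ Leray–Hopf on every [0,T]) → (b2: classical LH from
rapidly decaying datum ∈ L^∞L^∞ on (0,T'), T'<T) →
Literature.Analysis.FluidPDE.weak_strong_uniqueness → (time-restriction of Leray–Hopf solutions,
in-tree fact shape Literature.Analysis.FluidPDE.IsLerayHopfOn.mono, guarded 0<T'≤T) → X5b
(stmt-NavierStokesRegularity-0153 verbatim). Proof sketch (~40 lines): for t ∈ (0,T) pick T' ∈
(t,T); u is LH on [0,T'] by (b1); v restricted is LH on [0,T'] and in MemLqLp ⊤ ⊤ on (0,T') by (b2);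
weak_strong_uniqueness (r = ⊤ > 3, 2/⊤+3/⊤ = 0 ≤ 1) gives u t =ᵐ v t; both slices are continuous
(IsSmoothOnHalfSpace / IsClassicalNSSolutionOn.contDiff_velocity) and volume on EuclideanSpace is an
IsOpenPosMeasure, so u t = v t (Continuous.ae_eq_iff_eq); t = 0 from the initial conditions
(IsNavierStokesSolution gives u 0 = u₀ = v 0). [sources: Prodi1959, Serrin1963,
RobinsonRodrigoSadowski2016] -/
@[route_item "route-NavierStokesRegularity-Blowup"]
def BlowupX5bGlue : Prop :=
  (∀ ν : ℝ, 0 < ν → ∀ (u₀ : EuclideanSpace ℝ (Fin 3) → EuclideanSpace ℝ (Fin 3)), Literature.Analysis.FluidPDE.HasRapidSpatialDecay u₀ → ∀ (u : ℝ → EuclideanSpace ℝ (Fin 3) → EuclideanSpace ℝ (Fin 3)) (p : ℝ → EuclideanSpace ℝ (Fin 3) → ℝ), Literature.Analysis.FluidPDE.IsSmoothOnHalfSpace u → Literature.Analysis.FluidPDE.IsSmoothOnHalfSpace p → Literature.Analysis.FluidPDE.IsNavierStokesSolution ν 0 u₀ u p → Literature.Analysis.FluidPDE.HasBoundedEnergy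 u → ∀ T : ℝ, 0 < T → Literature.Analysis.FluidPDE.IsLerayHopfOn T ν 0 u₀ u) → (∀ (ν T : ℝ), 0 < ν → 0 < T → ∀ (u : ℝ → EuclideanSpace ℝ (Fin 3) → EuclideanSpace ℝ (Fin 3)) (p : ℝ → EuclideanSpace ℝ (Fin 3) → ℝ), Literature.Analysis.FluidPDE.IsClassicalNSSolutionOn (Set.Ico 0 T) ν 0 u p → Literature.Analysis.FluidPDE.IsLerayHopfOn T ν 0 (u 0) u → Literature.Analysis.FluidPDE.HasRapidSpatialDecay (u 0) → ∀ T' ∈ Set.Ioo 0 T, Literature.Analysis.FluidPDE.MemLqLp ⊤ ⊤ u (Set.Ioo 0 T')) → Literature.Analysis.FluidPDE.weak_strong_uniqueness → (∀ (T T' ν : ℝ) (u₀ : EuclideanSpace ℝ (Fin 3) → EuclideanSpace ℝ (Fin 3)) (u : ℝ → EuclideanSpace ℝ (Fin 3) → EuclideanSpace ℝ (Fin 3)), Literature.Analysis.FluidPDE.IsLerayHopfOn T ν 0 u₀ u → 0 < T' → T' ≤ T → Literature.Analysis.FluidPDE.IsLerayHopfOn T' ν 0 u₀ u) → (∀ ν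 : ℝ, 0 < ν → ∀ (u₀ : EuclideanSpace ℝ (Fin 3) → EuclideanSpace ℝ (Fin 3)), Literature.Analysis.FluidPDE.HasRapidSpatialDecay u₀ → ∀ (u v : ℝ → EuclideanSpace ℝ (Fin 3) → EuclideanSpace ℝ (Fin 3)) (p q : ℝ → EuclideanSpace ℝ (Fin 3) → ℝ) (T : ℝ), 0 < T → Literature.Analysis.FluidPDE.IsSmoothOnHalfSpace u → Literature.Analysis.FluidPDE.IsSmoothOnHalfSpace p → Literature.Analysis.FluidPDE.IsNavierStokesSolution ν 0 u₀ u p → Literature.Analysis.FluidPDE.HasBoundedEnergy u → Literature.Analysis.FluidPDE.IsClassicalNSSolutionOn (Set.Ico 0 T) ν 0 v q → Literature.Analysis.FluidPDE.IsLerayHopfOn T ν 0 u₀ v → v 0 = u₀ → ∀ t ∈ Set.Ico 0 T, u t = v t)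

/-- `BlowupX5bGlue` holds: proved by `Literature.NS.blowup_X5b_glue`. -/
theorem BlowupX5bGlue_holds : BlowupX5bGlue := _root_.Literature.NS.blowup_X5b_glue

/-- item stmt-NavierStokesRegularity-0730 · support · rank 8 · closed · moot by None · by planner
Cross-route bookkeeping, pure logic (~8 lines, verified sorry-free in scratch by refuter A-0 on
0150): X5a (stmt-NavierStokesRegularity-0152, route Blowup #2) is literally the negation of NoBlowup
(stmt-NavierStokesRegularity-0054, route TypeILiouville #0), since
Literature.Analysis.FluidPDE.IsMaximalSmoothSolution ν 0 u p T := IsClassicalNSSolutionOn (Ico 0 T)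
∧ ¬HasSmoothExtensionPast (ClassicalSolution.lean:245). Records in Lean that proving 0054 refutes
0152 (kills routes Blowup/CertifiedBlowup) and vice versa. Imports: ClassicalSolution, LerayHopf,
NSWave0. [sources: Fefferman2000, BealeKatoMajda1984] -/
@[route_item "route-NavierStokesRegularity-Blowup"]
def BlowupX5aIffNotNoBlowup : Prop :=
  (∃ ν : ℝ, 0 < ν ∧ ∃ T : ℝ, 0 < T ∧ ∃ (u : ℝ → EuclideanSpace ℝ (Fin 3) → EuclideanSpace ℝ (Fin 3)) (p : ℝ → EuclideanSpace ℝ (Fin 3) → ℝ), Literature.Analysis.FluidPDE.IsMaximalSmoothSolution ν 0 u p T ∧ Literature.Analysis.FluidPDE.IsLerayHopfOn T ν 0 (u 0) u ∧ Literature.Analysis.FluidPDE.HasRapidSpatialDecay (u 0)) ↔ ¬ (∀ (ν T : ℝ), 0 < ν → 0 < T → ∀ (u : ℝ → EuclideanSpace ℝ (Fin 3) → EuclideanSpace ℝ (Fin 3)) (p : ℝ → EuclideanSpace ℝ (Fin 3) → ℝ), Literature.Analysis.FluidPDE.IsClassicalNSSolutionOn (Set.Ico 0 T) ν 0 u p →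 Literature.Analysis.FluidPDE.IsLerayHopfOn T ν 0 (u 0) u → Literature.Analysis.FluidPDE.HasRapidSpatialDecay (u 0) → Literature.Analysis.FluidPDE.HasSmoothExtensionPast ν 0 u T)

/-- item stmt-NavierStokesRegularity-0761 · support · rank 9 · closed · moot by None · by planner
[support] A C¹ vector field on ℝ³ with Fefferman's rapid decay (4) (all Fréchet derivatives
O((1+|x|)^{-K}) for every K) is in H¹: u₀ ∈ L² and ∇u₀ ∈ L² (take K = 2, n = 0, 1; (1+|x|)^{-2} ∈
L²(ℝ³); measurability from continuity). Feeds the H¹-datum hypothesis of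
Literature.Analysis.FluidPDE.tao_unconditional_uniqueness_velocity in crux ClayUniquenessOfTao
(stmt-NavierStokesRegularity-0728). Elementary; ~80 lines. [sources: Fefferman2000 (4), Tao2011 Cor.
11.4] -/
@[route_item "route-NavierStokesRegularity-Blowup"]
def SchwartzDatumH1 : Prop :=
  ∀ (u₀ : EuclideanSpace ℝ (Fin 3) → EuclideanSpace ℝ (Fin 3)), ContDiff ℝ 1 u₀ → Literature.Analysis.FluidPDE.HasRapidSpatialDecay u₀ → MeasureTheory.MemLp u₀ 2 MeasureTheory.volume ∧ MeasureTheory.MemLp (fderiv ℝ u₀) 2 MeasureTheory.volume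

/-- item stmt-NavierStokesRegularity-0151 · assembly · rank 1 · closed · proved by Literature.NS.blowup_assembly (refuter) · by planner
Formal: apply A to the datum u 0 of X5a (smooth by IsClassicalNSSolutionOn.contDiff_velocity,
div-free by Literature.Analysis.FluidPDE.NSWave0.IsDivFree =
Literature.Analysis.FluidPDE.VectorCalculus.IsDivFree definitional shape, rapidly decaying by
hypothesis) to get a global Clay solution; X5b identifies it with the blowing-up solution on [0,T);
Literature.Analysis.FluidPDE.isNavierStokesSolution_and_smooth_iff and IsClassicalNSSolutionOn.mono
to Ico 0 (T+1) give HasSmoothExtensionPast, contradicting IsMaximalSmoothSolution. [sources: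
Fefferman2000, BealeKatoMajda1984] -/
@[route_item "route-NavierStokesRegularity-Blowup"]
def Assembly : Prop :=
  ((∃ ν : ℝ, 0 < ν ∧ ∃ T : ℝ, 0 < T ∧ ∃ (u : ℝ → EuclideanSpace ℝ (Fin 3) → EuclideanSpace ℝ (Fin 3)) (p : ℝ → EuclideanSpace ℝ (Fin 3) → ℝ), Literature.Analysis.FluidPDE.IsMaximalSmoothSolution ν 0 u p T ∧ Literature.Analysis.FluidPDE.IsLerayHopfOn T ν 0 (u 0) u ∧ Literature.Analysis.FluidPDE.HasRapidSpatialDecay (u 0)) ∧ (∀ ν : ℝ, 0 < ν → ∀ (u₀ : EuclideanSpace ℝ (Fin 3) → EuclideanSpace ℝ (Fin 3)), Literature.Analysis.FluidPDE.HasRapidSpatialDecay u₀ → ∀ (u v : ℝ → EuclideanSpace ℝ (Fin 3) → EuclideanSpace ℝ (Fin 3)) (p q : ℝ → EuclideanSpace ℝ (Fin 3) → ℝ) (T : ℝ), 0 < T → Literature.Analysis.FluidPDE.IsSmoothOnHalfSpace u → Literature.Analysis.FluidPDE.IsSmoothOnHalfSpace p → Literature.Analysis.FluidPDE.IsNavierStokesSolution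 ν 0 u₀ u p → Literature.Analysis.FluidPDE.HasBoundedEnergy u → Literature.Analysis.FluidPDE.IsClassicalNSSolutionOn (Set.Ico 0 T) ν 0 v q → Literature.Analysis.FluidPDE.IsLerayHopfOn T ν 0 u₀ v → v 0 = u₀ → ∀ t ∈ Set.Ico 0 T, u t = v t)) → ¬ NavierStokesRegularity

/-- `Assembly` holds: proved by `Literature.NS.blowup_assembly`. -/
theorem Assembly_holds : Assembly := _root_.Literature.NS.blowup_assembly

-- records of items no longer active in this route (dropped / restated):
-- earlier Assembly2 (stmt-NavierStokesRegularity-0760, dropped 2026-08-16T14:43:05Z): moot by None — (∃ ν : ℝ, 0 < ν ∧ ∃ T : ℝ, 0 < T ∧ ∃ (u : ℝ → EuclideanSpace ℝ (Fin 3) → EuclideanSpace ℝ (Fin 3)) (p : ℝ → EuclideanSpace ℝ (Fin 3) → ℝ), Literature.Analysis.FluidPDE.IsMaximalSmoothSolution ν 0 u p T ∧ Literature.Analysis.FluidPDE.IsLerayHopfOn T ν 0 (u 0) u ∧ Literature.Analysis.FluidPDE.HasRapidS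

/-! D-0027 §2.1 — DECIDING THEOREM (planner-authored via `route open/edit --closes-file`; by planner-rfix-NavierStokesRegularity-Blowup-0420b48a-0 2026-08-15T20:19:52Z) — ARCHIVED: route closed (refuted) 2026-08-18T19:55:24Z; kept so importers keep building:
its hypotheses are this route's items and its conclusion the sub-problem Statement (glue_lint), and it elaborates with this file. -/

/-- DECIDING THEOREM (D-0027 §2.1), refutation side: finite-time blow-up of a maximal smooth
Leray–Hopf solution from a rapidly decaying datum (`BlowupExists`, crux #2 = X5a) together with
uniqueness of Fefferman class-(A) solutions against the classical solution on its interval of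
existence (`BlowupClayUniqueness`, support #3 = X5b — PROVED in Lean 2026-08-15 inside
`Theorems/BlowupBlowupClayNonuniquenessRefutation.lean` from the in-tree theorem
`Literature.Analysis.FluidPDE.tao_unconditional_uniqueness_velocity_holds`, Tao2011 Cor. 11.4; the item
closes when a prover re-lands that proof as `theorem … : Blowup.BlowupClayUniqueness`) refutes Clay (A).
The refuted loophole item `BlowupClayNonuniqueness` (¬X5b, stmt-NavierStokesRegularity-0154) is NOT a
hypothesis: its refutation is the settled negative edge ¬¬X5b and strengthens this theorem's second
premise. Same argument as the proved assembly `Literature.NS.blowup_assembly` (item `Assembly`), inlined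
so that it needs no Theorems import: apply (A) to the datum `u 0`; X5b glues the global Clay-class
solution to the blowing-up one on `[0,T)`; its restriction to `[0,T+1)` is a smooth extension past `T`,
contradicting maximality. -/
@[closes "route-NavierStokesRegularity-Blowup"] theorem closes (hX5a : BlowupExists) (hX5b : BlowupClayUniqueness) : ¬ NavierStokesRegularity := by
  rintro hA
  obtain ⟨ν, hν, T, hT, u, p, ⟨hcl, hmax⟩, hLH, hdec⟩ := hX5a
  have h0 : (0 : ℝ) ∈ Set.Ico 0 T := ⟨le_rfl, hT⟩
  obtain ⟨u', p', hu', hp', hns, hbe⟩ :=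
    hA ν hν (u 0) (hcl.contDiff_velocity h0) (hcl.divFree 0 h0) hdec
  have heq : ∀ t ∈ Set.Ico 0 T, u' t = u t :=
    hX5b ν hν (u 0) hdec u' u p' p T hT hu' hp' hns hbe hcl hLH rfl
  have hcl' : Literature.Analysis.FluidPDE.IsClassicalNSSolutionOn (Set.Ici 0) ν 0 u' p' :=
    ⟨hu', hp', fun t ht x => hns.momentum t ht x, fun t ht => hns.divFree t ht⟩
  refine hmax ⟨T + 1, by linarith, u', p', ?_, heq⟩
  exact hcl'.mono (fun t ht => ht.1) (uniqueDiffOn_Ico 0 (T + 1))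

end Summit.NavierStokesRegularity.NavierStokesRegularity.Theses.Blowup
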